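import Summits.BirchSwinnertonDyer.BirchSwinnertonDyer.Theorems.GenusKolyvaginAtTwoGenusPrimitiveSupplyAtTwoArchimedeanDescAdmissible
import HarnessLib

/-!
# Route `GenusKolyvaginAtTwo`, crux #2 `GenusPrimitiveSupplyAtTwo` (stmt-BirchSwinnertonDyer-22136):
# the LEVEL LAW on the habitat — the T-A dichotomy's branch is decided by `W` alone (strictness of `Sel₂(W)` at `∞`), hence
# T-A′ `AdmissibleTwistSelmerLevelAtTwo` and T-V `StrictShaPropagationAtTwo` on the habitat, modulo {PT, Tate χ, Kramer parity}

Width seat `bsd-line-gk2-p5` g9 (cell `bsd-f1-sign2`, SUPPLY lineage, «UP general-K lane»), file 27 of the series (sequel of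
`…ArchimedeanDescAdmissible.lean` p638445). THEOREMS ONLY (no definition, no named fact, no `sorry`, no local instance); helper
`--supports stmt-BirchSwinnertonDyer-22136`; no item is closed; BSD is not proved by any of this.

WHAT. In Mazur–Rubin's Cor. 3.4 (i) with the single real `T`-place (files 21–25) the direction is decided by `W` ALONE: UP
(`#Sel₂(W^{(d)}) = 2·#Sel₂(W)`) iff `Sel₂(W)` is STRICT at `∞` (every Selmer class localises to `0` in `H¹(ℝ, W[2])`), DOWN
(`2·#Sel₂(W^{(d)}) = #Sel₂(W)`) iff some Selmer class is non-trivial at `∞` — for EVERY descent-admissible `d`. Hence: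

* §67 `natCard_selmerGroup_twist_eq_mul_two_of_descAdmissible_of_strict` (UP) / `natCard_selmerGroup_twist_mul_two_eq_of_descAdmissible_of_exists`
  (DOWN) — φ-free, in `DescAdmissible` currency, modulo {PT, Tate χ[, Kramer parity]};
* §68 `twistSelmerTwoCard_eq_two_mul_of_strict` / `two_mul_twistSelmerTwoCard_eq_of_exists` (the cell's `twistSelmerTwoCard` /
  `selmerTwoCard` currency) and **`admissibleTwistSelmerLevel_habitat_of_parity`** — T-A′'s conclusion verbatim
  (`twistSelmerTwoCard W d = twistSelmerTwoCard W d'` for all descent-admissible `d, d'`) on `{ρ̄₂ onto, Δ > 0, globally minimal}`;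
* §69 **`strictShaPropagation_habitat_of_parity`** — T-V's conclusion verbatim (`(∀ d adm, #Sel₂(W^{(d)}) = 2) ∨ (∀ d adm, = 8)`) on
  `{ρ̄₂ onto, Δ > 0, #Sel₂(W) = 4}` (the rank hypothesis of T-V is not needed), modulo {PT, Tate χ, Kramer parity} only.

References: [MazurRubin2010] Thm. 2.7, Lemma 2.9, Prop. 3.3, Cor. 3.4 (i); [Kramer1981] §2 Prop. 6, Thm. 1; [MilneADT2006] I Thm. 2.8, 2.13, 4.10.
-/

set_option linter.dupNamespace false -- tree convention: `Summit.BirchSwinnertonDyer.BirchSwinnertonDyer.Theorems` (summit = sub-problem)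
set_option autoImplicit false

noncomputable section

open scoped Classical ContRepresentation

namespace Summit.BirchSwinnertonDyer.BirchSwinnertonDyer.Theorems.GenusKolyArch

open WeierstrassCurve Field NumberField IsDedekindDomain Function
open Literature.NumberTheory.EllipticCurves Literature.NumberTheory.GaloisRepresentations
open Literature.NumberTheory.GaloisCohomology
open Summit.BirchSwinnertonDyer.BirchSwinnertonDyer.Theorems.GenusKolyTwistLocal
open Summit.BirchSwinnertonDyer.Rank1Residual.F1Sign2

variable (W : WeierstrassCurve ℚ) [W.IsElliptic] [W.IsGloballyMinimal]

/-! ## §67 UP and DOWN separately, φ-free, in `DescAdmissible` currency -/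

/-- A negative integer is not a square in `ℚ`. [folklore] -/
theorem forall_sq_ne_intCast_of_neg {d : ℤ} (hd : d < 0) : ∀ x : ℚ, x ^ 2 ≠ ((d : ℤ) : ℚ) := fun x hx ↦ by
  have h0 : (0 : ℚ) ≤ (d : ℚ) := by rw [← hx]; exact sq_nonneg x
  exact absurd (by exact_mod_cast h0 : (0 : ℤ) ≤ d) (not_le.mpr hd)

/-- **UP for a descent-admissible twist, when `Sel₂(W)` is strict at `∞`** — kernel theorem modulo {PT, Tate χ, Kramer parity}: `W/ℚ`
globally minimal with `ρ̄_{W,2}` onto and `Δ_W > 0`, `d` descent-admissible, `Wd = C • W^{(d)}`; if every class of `Sel₂(W)` localises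
to `0` at the real place, then `#Sel₂(Wd) = #Sel₂(W) · 2`. [cite: MazurRubin2010, Thm. 2.7, Lemma 2.9, Prop. 3.3, Cor. 3.4 (i)]
[cite: Kramer1981, §2 Prop. 6, Thm. 1] -/
theorem natCard_selmerGroup_twist_eq_mul_two_of_descAdmissible_of_strict
    (hPT : poitouTate_selmerStructure_duality_real ℚ)
    (hEP : ∀ v : HeightOneSpectrum (𝓞 ℚ), localEulerPoincareCharacteristic (v.adicCompletion ℚ))
    (hKP : MazurRubin2010.kramerParity ℚ) (hsurj : W.HasSurjectiveModNGaloisRep 2) (hΔ : 0 < W.Δ)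
    {d : ℤ} (hd : DescAdmissible W d) {Wd : WeierstrassCurve ℚ} [Wd.IsElliptic] {C : VariableChange ℚ}
    (hC : C • W.quadraticTwist (d : ℚ) = Wd)
    (hstrict : ∀ c ∈ (W.kummerSelmerStructure ((2 : ℕ) : ℤ)).selmerGroup,
      galoisCohomology.localization (W.torsionGaloisModule ((2 : ℕ) : ℤ)) (Sum.inl Rat.infinitePlace) 1 c = 0) :
    Nat.card (Wd.selmerGroup 2) = Nat.card (W.selmerGroup 2) * 2 := by
  have hdneg : d < 0 := hd.1
  have hd0' : ((d : ℤ) : ℚ) ≠ 0 := by exact_mod_cast hdneg.ne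
  obtain ⟨φ, ψ, hψφ, hφψ, hsplit, hreal⟩ := exists_intertwining_hsplit_and_transverse_inl W hd0' hC
  have hw₀ : (Rat.infinitePlace).IsReal := Rat.isReal_infinitePlace
  have hΔ' : 0 < InfinitePlace.embedding_of_isReal hw₀ W.Δ := by rwa [embedding_of_isReal_rat_apply, Rat.cast_pos]
  have hinf : ∀ w : InfinitePlace ℚ, w ≠ Rat.infinitePlace →
      (∃ s : w.Completion, s ^ 2 = algebraMap ℚ w.Completion ((d : ℤ) : ℚ)) ∨
      ((∀ x : galoisCohomology (W.localGaloisModule w.Completion) 1, x = 0) ∧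
        (∀ x : galoisCohomology (Wd.localGaloisModule w.Completion) 1, x = 0)) :=
    fun w hw ↦ absurd (Subsingleton.elim w _) hw
  have h := natCard_selmerGroup_twist_eq_mul_two_of_places_inl_of_parity W hPT hEP hKP hsurj
    (forall_sq_ne_intCast_of_neg hdneg) hC φ ψ hψφ hφψ hsplit hw₀ hΔ' (descAdmissible_place_menu W hd hC φ ψ hψφ hφψ) hinf
    (hreal _ hw₀ hΔ' (forall_sq_ne_completion_of_neg (by exact_mod_cast hdneg) _)) hstrict
  simpa only [Nat.cast_ofNat] using h

/-- **DOWN for a descent-admissible twist, when some class of `Sel₂(W)` is non-trivial at `∞`** — kernel theorem modulo {PT, Tate χ}: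
`W/ℚ` globally minimal with `Δ_W > 0`, `d` descent-admissible, `Wd = C • W^{(d)}`: `#Sel₂(Wd) · 2 = #Sel₂(W)`.
[cite: MazurRubin2010, Lemma 2.9, Prop. 3.3, Cor. 3.4 (i)] [cite: Kramer1981, §2 Prop. 6] [cite: MilneADT2006, I Thm. 2.13, 4.10] -/
theorem natCard_selmerGroup_twist_mul_two_eq_of_descAdmissible_of_exists
    (hPT : poitouTate_selmerStructure_duality_real ℚ)
    (hEP : ∀ v : HeightOneSpectrum (𝓞 ℚ), localEulerPoincareCharacteristic (v.adicCompletion ℚ))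
    (hΔ : 0 < W.Δ) {d : ℤ} (hd : DescAdmissible W d) {Wd : WeierstrassCurve ℚ} [Wd.IsElliptic] {C : VariableChange ℚ}
    (hC : C • W.quadraticTwist (d : ℚ) = Wd)
    (hns : ∃ c ∈ (W.kummerSelmerStructure ((2 : ℕ) : ℤ)).selmerGroup,
      galoisCohomology.localization (W.torsionGaloisModule ((2 : ℕ) : ℤ)) (Sum.inl Rat.infinitePlace) 1 c ≠ 0) :
    Nat.card (Wd.selmerGroup 2) * 2 = Nat.card (W.selmerGroup 2) := by
  have hdneg : d < 0 := hd.1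
  have hd0' : ((d : ℤ) : ℚ) ≠ 0 := by exact_mod_cast hdneg.ne
  obtain ⟨φ, ψ, hψφ, hφψ, hsplit, hreal⟩ := exists_intertwining_hsplit_and_transverse_inl W hd0' hC
  have hw₀ : (Rat.infinitePlace).IsReal := Rat.isReal_infinitePlace
  have hΔ' : 0 < InfinitePlace.embedding_of_isReal hw₀ W.Δ := by rwa [embedding_of_isReal_rat_apply, Rat.cast_pos]
  have hinf : ∀ w : InfinitePlace ℚ, w ≠ Rat.infinitePlace →
      (∃ s : w.Completion, s ^ 2 = algebraMap ℚ w.Completion ((d : ℤ) : ℚ)) ∨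
      ((∀ x : galoisCohomology (W.localGaloisModule w.Completion) 1, x = 0) ∧
        (∀ x : galoisCohomology (Wd.localGaloisModule w.Completion) 1, x = 0)) :=
    fun w hw ↦ absurd (Subsingleton.elim w _) hw
  have h := natCard_selmerGroup_twist_mul_two_eq_of_places_inl W hPT hEP φ ψ hψφ hφψ hsplit hw₀ hΔ'
    (descAdmissible_place_menu W hd hC φ ψ hψφ hφψ) hinf
    (hreal _ hw₀ hΔ' (forall_sq_ne_completion_of_neg (by exact_mod_cast hdneg) _)) hns
  simpa only [Nat.cast_ofNat] using h

/-! ## §68 The level law in the cell's currency; T-A′ on the habitat -/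

/-- **UP in the cell's currency**: `Sel₂(W)` strict at `∞` ⟹ `#Sel₂(W^{(d)}) = 2·#Sel₂(W)` for every descent-admissible `d`.
[cite: MazurRubin2010, Thm. 2.7, Cor. 3.4 (i)] [cite: Kramer1981, §2 Prop. 6] -/
theorem twistSelmerTwoCard_eq_two_mul_of_strict
    (hPT : poitouTate_selmerStructure_duality_real ℚ)
    (hEP : ∀ v : HeightOneSpectrum (𝓞 ℚ), localEulerPoincareCharacteristic (v.adicCompletion ℚ))
    (hKP : MazurRubin2010.kramerParity ℚ) (hsurj : W.HasSurjectiveModNGaloisRep 2) (hΔ : 0 < W.Δ)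
    (hstrict : ∀ c ∈ (W.kummerSelmerStructure ((2 : ℕ) : ℤ)).selmerGroup,
      galoisCohomology.localization (W.torsionGaloisModule ((2 : ℕ) : ℤ)) (Sum.inl Rat.infinitePlace) 1 c = 0)
    {d : ℤ} (hd : DescAdmissible W d) :
    twistSelmerTwoCard W d = 2 * selmerTwoCard W := by
  have hd0 : d ≠ 0 := hd.1.ne
  haveI := W.isElliptic_quadraticTwist (show ((d : ℤ) : ℚ) ≠ 0 by exact_mod_cast hd0)
  have hC : (1 : VariableChange ℚ) • W.quadraticTwist ((d : ℤ) : ℚ) = W.quadraticTwist ((d : ℤ) : ℚ) := one_smul _ _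
  have h := natCard_selmerGroup_twist_eq_mul_two_of_descAdmissible_of_strict W hPT hEP hKP hsurj hΔ hd hC hstrict
  rw [GenusKolyTwin.natCard_selmerGroup_model_eq_twistSelmerTwoCard W hd0 _ ⟨1, hC⟩] at h
  rw [h, selmerTwoCard, mul_comm]

/-- **DOWN in the cell's currency**: some class of `Sel₂(W)` non-trivial at `∞` ⟹ `2·#Sel₂(W^{(d)}) = #Sel₂(W)` for every
descent-admissible `d`. [cite: MazurRubin2010, Cor. 3.4 (i)] [cite: Kramer1981, §2 Prop. 6] -/
theorem two_mul_twistSelmerTwoCard_eq_of_exists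
    (hPT : poitouTate_selmerStructure_duality_real ℚ)
    (hEP : ∀ v : HeightOneSpectrum (𝓞 ℚ), localEulerPoincareCharacteristic (v.adicCompletion ℚ))
    (hΔ : 0 < W.Δ)
    (hns : ∃ c ∈ (W.kummerSelmerStructure ((2 : ℕ) : ℤ)).selmerGroup,
      galoisCohomology.localization (W.torsionGaloisModule ((2 : ℕ) : ℤ)) (Sum.inl Rat.infinitePlace) 1 c ≠ 0)
    {d : ℤ} (hd : DescAdmissible W d) :
    2 * twistSelmerTwoCard W d = selmerTwoCard W := by
  have hd0 : d ≠ 0 := hd.1.ne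
  haveI := W.isElliptic_quadraticTwist (show ((d : ℤ) : ℚ) ≠ 0 by exact_mod_cast hd0)
  have hC : (1 : VariableChange ℚ) • W.quadraticTwist ((d : ℤ) : ℚ) = W.quadraticTwist ((d : ℤ) : ℚ) := one_smul _ _
  have h := natCard_selmerGroup_twist_mul_two_eq_of_descAdmissible_of_exists W hPT hEP hΔ hd hC hns
  rw [GenusKolyTwin.natCard_selmerGroup_model_eq_twistSelmerTwoCard W hd0 _ ⟨1, hC⟩] at h
  rw [selmerTwoCard, ← h, mul_comm]

/-- **T-A′ `F1Sign2.AdmissibleTwistSelmerLevelAtTwo` ON THE HABITAT (`d`-independence of `#Sel₂(W^{(d)})` = well-definedness of the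
descent sign `ε(W)`), modulo {PT, Tate χ, Kramer parity}**: for `W/ℚ` globally minimal with `ρ̄_{W,2}` onto and `Δ_W > 0`,
`#Sel₂(W^{(d)}) = #Sel₂(W^{(d')})` for all descent-admissible `d, d'` — both are `2·#Sel₂(W)` if `Sel₂(W)` is strict at `∞`, both
`#Sel₂(W)/2` otherwise. [cite: MazurRubin2010, Thm. 2.7, Cor. 3.4 (i)] [cite: Kramer1981, §2 Prop. 6] -/
theorem admissibleTwistSelmerLevel_habitat_of_parity
    (hPT : poitouTate_selmerStructure_duality_real ℚ)
    (hEP : ∀ v : HeightOneSpectrum (𝓞 ℚ), localEulerPoincareCharacteristic (v.adicCompletion ℚ))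
    (hKP : MazurRubin2010.kramerParity ℚ) (hsurj : W.HasSurjectiveModNGaloisRep 2) (hΔ : 0 < W.Δ)
    {d d' : ℤ} (hd : DescAdmissible W d) (hd' : DescAdmissible W d') :
    twistSelmerTwoCard W d = twistSelmerTwoCard W d' := by
  by_cases hstrict : ∀ c ∈ (W.kummerSelmerStructure ((2 : ℕ) : ℤ)).selmerGroup,
      galoisCohomology.localization (W.torsionGaloisModule ((2 : ℕ) : ℤ)) (Sum.inl Rat.infinitePlace) 1 c = 0
  · rw [twistSelmerTwoCard_eq_two_mul_of_strict W hPT hEP hKP hsurj hΔ hstrict hd,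
      twistSelmerTwoCard_eq_two_mul_of_strict W hPT hEP hKP hsurj hΔ hstrict hd']
  · push Not at hstrict
    obtain ⟨c, hc, hne⟩ := hstrict
    have h1 := two_mul_twistSelmerTwoCard_eq_of_exists W hPT hEP hΔ ⟨c, hc, hne⟩ hd
    have h2 := two_mul_twistSelmerTwoCard_eq_of_exists W hPT hEP hΔ ⟨c, hc, hne⟩ hd'
    omega

/-! ## §69 T-V on the habitat -/

/-- **T-V `F1Sign2.StrictShaPropagationAtTwo` ON THE HABITAT, modulo {PT, Tate χ, Kramer parity}**: for `W/ℚ` globally minimal with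
`ρ̄_{W,2}` onto, `Δ_W > 0` and `#Sel₂(W) = 4`, EITHER every descent-admissible twist has `#Sel₂ = 2` (some class of `Sel₂(W)` is
non-trivial at `∞`: DOWN) OR every descent-admissible twist has `#Sel₂ = 8` (`Sel₂(W)` strict at `∞`: UP). T-V's rank-`0` hypothesis is
not used. [cite: MazurRubin2010, Thm. 2.7, Cor. 3.4 (i)] [cite: Kramer1981, §2 Prop. 6] [cite: CremonaMazur2000, §3] -/
theorem strictShaPropagation_habitat_of_parity
    (hPT : poitouTate_selmerStructure_duality_real ℚ)
    (hEP : ∀ v : HeightOneSpectrum (𝓞 ℚ), localEulerPoincareCharacteristic (v.adicCompletion ℚ))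
    (hKP : MazurRubin2010.kramerParity ℚ) (hsurj : W.HasSurjectiveModNGaloisRep 2) (hΔ : 0 < W.Δ)
    (h4 : selmerTwoCard W = 4) :
    (∀ d : ℤ, DescAdmissible W d → twistSelmerTwoCard W d = 2) ∨
      (∀ d : ℤ, DescAdmissible W d → twistSelmerTwoCard W d = 8) := by
  by_cases hstrict : ∀ c ∈ (W.kummerSelmerStructure ((2 : ℕ) : ℤ)).selmerGroup,
      galoisCohomology.localization (W.torsionGaloisModule ((2 : ℕ) : ℤ)) (Sum.inl Rat.infinitePlace) 1 c = 0
  · right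
    intro d hd
    rw [twistSelmerTwoCard_eq_two_mul_of_strict W hPT hEP hKP hsurj hΔ hstrict hd, h4]
  · left
    push Not at hstrict
    obtain ⟨c, hc, hne⟩ := hstrict
    intro d hd
    have h := two_mul_twistSelmerTwoCard_eq_of_exists W hPT hEP hΔ ⟨c, hc, hne⟩ hd
    omega

end Summit.BirchSwinnertonDyer.BirchSwinnertonDyer.Theorems.GenusKolyArch

end
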